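import Literature.Probability.LatticeModels.OSReconstructionAbstract
import Mathlib.MeasureTheory.Integral.Bochner.ContinuousLinearMap
import HarnessLib

/-!
# Osterwalder–Schrader reconstruction for a reflection-positive lattice measure

The measure-theoretic layer over `OSReconstructionAbstract.lean`: for a probability measure `μ` on `Ω` with a
measurable measure-preserving involution `reflect` (time reflection), a measurable measure-preserving `shift` (unit
time translation) conjugated to its inverse by the reflection (`shift ∘ reflect ∘ shift = reflect`) and mapping the
positive-time σ-algebra `mpos` into itself, and REFLECTION POSITIVITY `0 ≤ Re ∫ conj (F ∘ reflect) · F dμ` on bounded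
`mpos`-measurable observables (`IsRPMeasureData`), we CONSTRUCT the objects that `TransferOperator.lean` packages as the
hypothesis structure `IsOSRealisation μ reflect shift mpos ι D` (Glimm–Jaffe 1987 §6.1 Thm. 6.1.3; Osterwalder–Seiler
1978 §2; Seiler LNP 159 Ch. 2):

* the OS form `⟪F, G⟫ = ∫ conj (F ∘ reflect) · G dμ` on the submodule `bddMeasurable mpos` of bounded positive-time
  observables (`IsRPMeasureData.core`: Hermitian by the change of variables `ω ↦ reflect ω`, positive by RP);
* the shift endomorphism `F ↦ F ∘ shift` (`shiftOp`): SYMMETRIC for the form (change of variables `ω ↦ shift ω` and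
  `shift ∘ reflect ∘ shift = reflect`) with BOUNDED ORBITS (`Re ⟪SⁿF, SⁿF⟫ ≤ ‖F‖_∞²`);
* hence, by the abstract layer (iterated Schwarz inequality ⇒ contraction; quotient; completion), the transfer data
  `rpTransferData` and the OS map `rpMap`, and the theorem `isOSRealisation_of_isRPMeasureData`: they REALISE `μ` —
  `⟪ι F, ι G⟫ = ∫ conj (F ∘ reflect) G dμ`, `ι (G ∘ shift) = T (ι G)`, `ι 1 = Ω`, dense range — under the extra
  hypothesis that the one-step shift is positive (`0 ≤ Re ∫ conj (F ∘ reflect)(F ∘ shift) dμ`, true e.g. when the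
  measure is reflection positive about integer AND half-integer hyperplanes);
* and unconditionally for the TWO-STEP shift (`isOSRealisation_two_step`: `Re ⟪F, S²F⟫ = Re ⟪SF, SF⟫ ≥ 0`), the form
  in which a site-reflection-positive lattice theory always has a positive transfer matrix `T = S̄²`.

With `LatticeMassGapProofs` (clustering on a dense set ⇔ gap), `TransferTruncatedSchwarzBound` and
`TransferDecayUpgrade` this closes the loop "RP lattice measure ⇒ honest transfer operator ⇒ spectral reading of
clustering" inside the tree. [cite: GlimmJaffe1987, §6.1 Thm. 6.1.3] [cite: OsterwalderSeiler1978, §2]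
[cite: Seiler1982, Ch. 2]
-/

noncomputable section

open scoped InnerProductSpace ComplexConjugate

namespace Literature.Probability.LatticeModels

open MeasureTheory

section Measure

variable {Ω : Type*}

/-- **Reflection-positive lattice measure data** — the hypotheses of the Osterwalder–Schrader reconstruction for a
measure `μ` on `Ω` with time reflection `reflect`, unit time translation `shift` and positive-time σ-algebra `mpos`
(Glimm–Jaffe 1987 §6.1; Osterwalder–Seiler 1978 §2): `μ` is a probability measure; `mpos` is a sub-σ-algebra;
`reflect` is a measurable, measure-preserving involution; `shift` is measurable, measure preserving, maps positive-time
observables to positive-time observables and is conjugated to its inverse by the reflection (`shift ∘ reflect ∘ shift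
= reflect`); and REFLECTION POSITIVITY: `0 ≤ Re ∫ conj (F ∘ reflect) · F dμ` for bounded `mpos`-measurable `F`.
[cite: GlimmJaffe1987, §6.1 Thm. 6.1.3] [cite: OsterwalderSeiler1978, §2] -/
structure IsRPMeasureData {mΩ : MeasurableSpace Ω} (μ : Measure Ω) (reflect shift : Ω → Ω)
    (mpos : MeasurableSpace Ω) : Prop where
  /-- `μ` is a probability measure. -/
  isProbabilityMeasure : IsProbabilityMeasure μ
  /-- the positive-time σ-algebra is a sub-σ-algebra. -/
  le : mpos ≤ mΩ
  /-- the reflection is measurable. -/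
  measurable_reflect : @Measurable Ω Ω mΩ mΩ reflect
  /-- the reflection is an involution. -/
  reflect_involutive : Function.Involutive reflect
  /-- the reflection preserves `μ`. -/
  measurePreserving_reflect : @MeasurePreserving Ω Ω mΩ mΩ reflect μ μ
  /-- the shift is measurable. -/
  measurable_shift : @Measurable Ω Ω mΩ mΩ shift
  /-- the shift preserves `μ`. -/
  measurePreserving_shift : @MeasurePreserving Ω Ω mΩ mΩ shift μ μ
  /-- the reflection conjugates the shift to its inverse. -/
  shift_reflect_shift : ∀ ω, shift (reflect (shift ω)) = reflect ω
  /-- the shift maps positive-time observables to positive-time observables. -/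
  measurable_comp_shift : ∀ G : Ω → ℂ, Measurable[mpos] G → Measurable[mpos] (G ∘ shift)
  /-- REFLECTION POSITIVITY on bounded positive-time observables. -/
  rp : ∀ F : Ω → ℂ, IsBoundedMeasurable mpos F →
    0 ≤ RCLike.re (∫ ω, starRingEnd ℂ (F (reflect ω)) * F ω ∂μ)

section Observables

variable (mpos : MeasurableSpace Ω)

/-- The `ℂ`-submodule of bounded `mpos`-measurable observables `Ω → ℂ`. [folklore] -/
def bddMeasurable : Submodule ℂ (Ω → ℂ) where
  carrier := {F | IsBoundedMeasurable mpos F}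
  add_mem' := by
    rintro F G ⟨hFm, CF, hF⟩ ⟨hGm, CG, hG⟩
    exact ⟨hFm.add hGm, CF + CG, fun ω => (norm_add_le _ _).trans (add_le_add (hF ω) (hG ω))⟩
  zero_mem' := ⟨measurable_const, 0, fun ω => by simp⟩
  smul_mem' := by
    rintro r F ⟨hFm, CF, hF⟩
    exact ⟨hFm.const_smul r, ‖r‖ * CF, fun ω => by
      rw [Pi.smul_apply, norm_smul]; exact mul_le_mul_of_nonneg_left (hF ω) (norm_nonneg _)⟩

/-- Membership in `bddMeasurable` is `IsBoundedMeasurable`. [folklore] -/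
theorem mem_bddMeasurable {F : Ω → ℂ} : F ∈ bddMeasurable mpos ↔ IsBoundedMeasurable mpos F := Iff.rfl

/-- The unit observable as an element of `bddMeasurable`. [folklore] -/
def bddOne : bddMeasurable mpos := ⟨1, isBoundedMeasurable_one mpos⟩

/-- The unit observable is the constant `1`. [folklore] -/
@[simp] theorem coe_bddOne : (bddOne mpos : Ω → ℂ) = 1 := rfl

end Observables

variable {mpos : MeasurableSpace Ω} {mΩ : MeasurableSpace Ω} {μ : Measure Ω} {reflect shift : Ω → Ω}

namespace IsRPMeasureData

variable (h : IsRPMeasureData (mΩ := mΩ) μ reflect shift mpos)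
include h

/-- A bounded `mpos`-measurable observable is measurable. [folklore] -/
theorem measurable_of_mem {F : Ω → ℂ} (hF : IsBoundedMeasurable mpos F) : Measurable[mΩ] F :=
  hF.1.mono h.le le_rfl

/-- The reflected pairing integrand `conj (F ∘ reflect) · G` of two bounded measurable observables is integrable.
[folklore] -/
theorem integrable_pairing {F G : Ω → ℂ} (hF : IsBoundedMeasurable mpos F) (hG : IsBoundedMeasurable mpos G) :
    Integrable (fun ω => starRingEnd ℂ (F (reflect ω)) * G ω) μ := by
  haveI := h.isProbabilityMeasure
  obtain ⟨CF, hCF⟩ := hF.2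
  obtain ⟨CG, hCG⟩ := hG.2
  have hmeas : Measurable[mΩ] fun ω => starRingEnd ℂ (F (reflect ω)) * G ω :=
    ((Complex.continuous_conj.measurable.comp ((h.measurable_of_mem hF).comp h.measurable_reflect)).mul
      (h.measurable_of_mem hG))
  refine Integrable.mono' (integrable_const (CF * CG)) hmeas.aestronglyMeasurable (ae_of_all _ fun ω => ?_)
  rw [norm_mul, RCLike.norm_conj]
  exact mul_le_mul (hCF _) (hCG _) (norm_nonneg _) ((norm_nonneg (F ω)).trans (hCF ω))

/-- Hermitian symmetry of the reflected pairing (reflection is a measure-preserving involution):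
`conj ∫ conj (G ∘ θ) F dμ = ∫ conj (F ∘ θ) G dμ`. [cite: GlimmJaffe1987, §6.1] -/
theorem conj_pairing {F G : Ω → ℂ} (hF : IsBoundedMeasurable mpos F) (hG : IsBoundedMeasurable mpos G) :
    starRingEnd ℂ (∫ ω, starRingEnd ℂ (G (reflect ω)) * F ω ∂μ) =
      ∫ ω, starRingEnd ℂ (F (reflect ω)) * G ω ∂μ := by
  rw [← integral_conj]
  simp only [map_mul, RingHomCompTriple.comp_apply, RingHom.id_apply]
  -- change variables `ω ↦ reflect ω` in the right-hand side
  have hg : AEStronglyMeasurable (fun ω => starRingEnd ℂ (F (reflect ω)) * G ω) (Measure.map reflect μ) := by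
    rw [h.measurePreserving_reflect.map_eq]
    exact (h.integrable_pairing hF hG).aestronglyMeasurable
  have := integral_map h.measurable_reflect.aemeasurable hg
  rw [h.measurePreserving_reflect.map_eq] at this
  rw [this]
  refine integral_congr_ae (ae_of_all _ fun ω => ?_)
  simp only [h.reflect_involutive ω]
  ring

/-- **The OS form** of reflection-positive measure data: `⟪F, G⟫ = ∫ conj (F ∘ reflect) · G dμ` on the bounded
positive-time observables, a positive-semidefinite Hermitian form. [cite: GlimmJaffe1987, §6.1 Thm. 6.1.3] -/
@[reducible] def core : PreInnerProductSpace.Core ℂ (bddMeasurable mpos) where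
  inner F G := ∫ ω, starRingEnd ℂ ((F : Ω → ℂ) (reflect ω)) * (G : Ω → ℂ) ω ∂μ
  conj_inner_symm F G := h.conj_pairing F.2 G.2
  re_inner_nonneg F := h.rp F F.2
  add_left F G K := by
    change ∫ ω, starRingEnd ℂ ((F : Ω → ℂ) (reflect ω) + (G : Ω → ℂ) (reflect ω)) * (K : Ω → ℂ) ω ∂μ = _
    simp only [map_add, add_mul]
    exact integral_add (h.integrable_pairing F.2 K.2) (h.integrable_pairing G.2 K.2)
  smul_left F G r := by
    change ∫ ω, starRingEnd ℂ (r • (F : Ω → ℂ) (reflect ω)) * (G : Ω → ℂ) ω ∂μ = _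
    simp only [smul_eq_mul, map_mul, mul_assoc]
    exact integral_const_mul _ _

/-- The inner product of the OS form, unfolded. [folklore] -/
theorem core_inner (F G : bddMeasurable mpos) :
    h.core.inner F G = ∫ ω, starRingEnd ℂ ((F : Ω → ℂ) (reflect ω)) * (G : Ω → ℂ) ω ∂μ := rfl

/-- **The shift as an endomorphism** of the bounded positive-time observables, `F ↦ F ∘ shift`. [folklore] -/
def shiftOp : bddMeasurable mpos →ₗ[ℂ] bddMeasurable mpos where
  toFun F := ⟨(F : Ω → ℂ) ∘ shift, h.measurable_comp_shift _ F.2.1,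
    F.2.2.imp fun _ hC ω => hC (shift ω)⟩
  map_add' _ _ := rfl
  map_smul' _ _ := rfl

/-- The shift endomorphism is composition with the shift. [folklore] -/
@[simp] theorem coe_shiftOp (F : bddMeasurable mpos) : (h.shiftOp F : Ω → ℂ) = (F : Ω → ℂ) ∘ shift := rfl

/-- Powers of the shift endomorphism are composition with iterates. [folklore] -/
theorem coe_shiftOp_pow (n : ℕ) (F : bddMeasurable mpos) :
    ((h.shiftOp ^ n) F : Ω → ℂ) = (F : Ω → ℂ) ∘ shift^[n] := by
  induction n with
  | zero => rfl
  | succ n ih =>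
    rw [pow_succ', Module.End.mul_apply, coe_shiftOp, ih, Function.iterate_succ, Function.comp_assoc]

/-- **The shift is symmetric for the OS form**: `⟪S F, G⟫ = ⟪F, S G⟫` (the reflection conjugates the shift to its
inverse and the shift preserves the measure). [cite: GlimmJaffe1987, §6.1 Thm. 6.1.3 (ii)] -/
theorem shiftOp_symm (F G : bddMeasurable mpos) :
    h.core.inner (h.shiftOp F) G = h.core.inner F (h.shiftOp G) := by
  rw [core_inner, core_inner]
  -- `∫ g dμ = ∫ g (shift ω) dμ` for the LEFT integrand `g`
  set g : Ω → ℂ := fun ω => starRingEnd ℂ ((h.shiftOp F : Ω → ℂ) (reflect ω)) * (G : Ω → ℂ) ω with hg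
  have hgi : Integrable g μ := h.integrable_pairing (h.shiftOp F).2 G.2
  have hgm : AEStronglyMeasurable g (Measure.map shift μ) := by
    rw [h.measurePreserving_shift.map_eq]; exact hgi.aestronglyMeasurable
  have hmap := integral_map h.measurable_shift.aemeasurable hgm
  rw [h.measurePreserving_shift.map_eq] at hmap
  -- `hmap : ∫ g dμ = ∫ g (shift ω) dμ`
  rw [hmap]
  refine integral_congr_ae (ae_of_all _ fun ω => ?_)
  simp only [hg, coe_shiftOp, Function.comp_apply, h.shift_reflect_shift ω]

/-- **Bounded orbits**: `Re ⟪Sⁿ F, Sⁿ F⟫ ≤ ‖F‖_∞²` (probability measure). [cite: GlimmJaffe1987, §6.1 Thm. 6.1.3 (iii)] -/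
theorem shiftOp_orbitBounded (F : bddMeasurable mpos) :
    ∃ C : ℝ, ∀ n : ℕ, RCLike.re (h.core.inner ((h.shiftOp ^ n) F) ((h.shiftOp ^ n) F)) ≤ C := by
  haveI := h.isProbabilityMeasure
  obtain ⟨CF, hCF⟩ := F.2.2
  refine ⟨CF * CF, fun n => ?_⟩
  rw [core_inner]
  refine (RCLike.re_le_norm _).trans ?_
  have hb : ∀ᵐ ω ∂μ, ‖starRingEnd ℂ (((h.shiftOp ^ n) F : Ω → ℂ) (reflect ω)) * ((h.shiftOp ^ n) F : Ω → ℂ) ω‖ ≤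
      CF * CF := ae_of_all _ fun ω => by
    rw [norm_mul, RCLike.norm_conj, coe_shiftOp_pow]
    simp only [Function.comp_apply]
    exact mul_le_mul (hCF _) (hCF _) (norm_nonneg _) ((norm_nonneg ((F : Ω → ℂ) ω)).trans (hCF ω))
  have := norm_integral_le_of_norm_le_const hb
  rwa [probReal_univ, mul_one] at this

/-- The shift fixes the unit observable. [folklore] -/
theorem shiftOp_bddOne : h.shiftOp (bddOne mpos) = bddOne mpos := rfl

/-- `⟪1, 1⟫ = 1` (probability measure). [folklore] -/
theorem core_inner_bddOne : h.core.inner (bddOne mpos) (bddOne mpos) = 1 := by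
  haveI := h.isProbabilityMeasure
  rw [core_inner]
  simp

/-- A POSITIVE one-step shift (`0 ≤ Re ∫ conj (F ∘ reflect) (F ∘ shift) dμ`) makes `Re ⟪S F, F⟫ ≥ 0`. [folklore] -/
theorem re_inner_shiftOp_nonneg
    (hpos : ∀ F : Ω → ℂ, IsBoundedMeasurable mpos F →
      0 ≤ RCLike.re (∫ ω, starRingEnd ℂ (F (reflect ω)) * F (shift ω) ∂μ))
    (F : bddMeasurable mpos) : 0 ≤ RCLike.re (h.core.inner (h.shiftOp F) F) := by
  rw [h.shiftOp_symm]
  exact hpos F F.2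

end IsRPMeasureData

/-- **The reconstructed transfer data of a reflection-positive measure** with a POSITIVE one-step shift
(`0 ≤ Re ∫ conj (F ∘ reflect) · (F ∘ shift) dμ`; e.g. a measure reflection positive about both integer and
half-integer hyperplanes, or — always — the two-step shift, `isOSRealisation_two_step`): `(T, Ω) =` (closure of
`F ↦ F ∘ shift`, class of `1`) on the OS Hilbert space. [cite: GlimmJaffe1987, §6.1 Thm. 6.1.3] -/
def rpTransferData (h : IsRPMeasureData (mΩ := mΩ) μ reflect shift mpos)
    (hpos : ∀ F : Ω → ℂ, IsBoundedMeasurable mpos F →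
      0 ≤ RCLike.re (∫ ω, starRingEnd ℂ (F (reflect ω)) * F (shift ω) ∂μ)) :
    TransferData (OSHilbert h.core) :=
  osTransferData h.core h.shiftOp h.shiftOp_symm h.shiftOp_orbitBounded (h.re_inner_shiftOp_nonneg hpos)
    (bddOne mpos) h.shiftOp_bddOne h.core_inner_bddOne

open scoped Classical in
/-- **The OS map of a reflection-positive measure**: a bounded positive-time observable goes to its class in the OS
Hilbert space (junk `0` elsewhere). [cite: GlimmJaffe1987, §6.1 Thm. 6.1.3] -/
def rpMap (h : IsRPMeasureData (mΩ := mΩ) μ reflect shift mpos) (F : Ω → ℂ) : OSHilbert h.core :=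
  if hF : IsBoundedMeasurable mpos F then osMap h.core ⟨F, hF⟩ else 0

/-- The OS map on bounded positive-time observables. [folklore] -/
theorem rpMap_of_mem (h : IsRPMeasureData (mΩ := mΩ) μ reflect shift mpos) {F : Ω → ℂ}
    (hF : IsBoundedMeasurable mpos F) : rpMap h F = osMap h.core ⟨F, hF⟩ := by
  simp [rpMap, hF]

/-- **Osterwalder–Schrader reconstruction for a reflection-positive lattice measure** (Glimm–Jaffe 1987 §6.1
Thm. 6.1.3; Osterwalder–Seiler 1978 §2): reflection-positive measure data with a positive one-step shift are REALISED
— in the sense of `IsOSRealisation` — by the OS Hilbert space of their form, the OS map and the reconstructed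
transfer data: `⟪ι F, ι G⟫ = ∫ conj (F ∘ reflect) G dμ`, `ι (G ∘ shift) = T (ι G)`, `ι 1 = Ω`, dense range.  This
discharges the construction that `TransferOperator.lean` packages as a hypothesis structure.
[cite: GlimmJaffe1987, §6.1 Thm. 6.1.3] [cite: OsterwalderSeiler1978, §2] -/
theorem isOSRealisation_of_isRPMeasureData (h : IsRPMeasureData (mΩ := mΩ) μ reflect shift mpos)
    (hpos : ∀ F : Ω → ℂ, IsBoundedMeasurable mpos F →
      0 ≤ RCLike.re (∫ ω, starRingEnd ℂ (F (reflect ω)) * F (shift ω) ∂μ)) :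
    IsOSRealisation (mΩ := mΩ) μ reflect shift mpos (rpMap h) (rpTransferData h hpos) where
  inner_eq F G hF hG := by
    rw [rpMap_of_mem h hF, rpMap_of_mem h hG, inner_osMap]
    rfl
  measurable_comp_shift := h.measurable_comp_shift
  map_shift G hG := by
    have hGs : IsBoundedMeasurable mpos (G ∘ shift) := (h.shiftOp ⟨G, hG⟩).2
    rw [rpMap_of_mem h hGs, rpMap_of_mem h hG, rpTransferData, osTransferData_T_osMap]
    rfl
  map_one := by
    rw [rpMap_of_mem h (isBoundedMeasurable_one mpos)]
    rfl
  dense := by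
    refine (denseRange_osMap h.core).mono ?_
    rintro _ ⟨F, rfl⟩
    exact ⟨F, F.2, rpMap_of_mem h F.2⟩

/-- Reflection-positive measure data for the shift give reflection-positive measure data for the TWO-STEP shift.
[folklore] -/
theorem IsRPMeasureData.two_step (h : IsRPMeasureData (mΩ := mΩ) μ reflect shift mpos) :
    IsRPMeasureData (mΩ := mΩ) μ reflect (shift ∘ shift) mpos where
  isProbabilityMeasure := h.isProbabilityMeasure
  le := h.le
  measurable_reflect := h.measurable_reflect
  reflect_involutive := h.reflect_involutive
  measurePreserving_reflect := h.measurePreserving_reflect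
  measurable_shift := h.measurable_shift.comp h.measurable_shift
  measurePreserving_shift := h.measurePreserving_shift.comp h.measurePreserving_shift
  shift_reflect_shift ω := by
    simp only [Function.comp_apply]
    rw [h.shift_reflect_shift, h.shift_reflect_shift]
  measurable_comp_shift G hG := by
    rw [← Function.comp_assoc]
    exact h.measurable_comp_shift _ (h.measurable_comp_shift _ hG)
  rp := h.rp

/-- **The two-step shift is always positive** for reflection-positive measure data:
`0 ≤ Re ∫ conj (F ∘ reflect) · (F ∘ shift ∘ shift) dμ = Re ⟪S F, S F⟫`. [cite: GlimmJaffe1987, §6.1 Thm. 6.1.3 (ii)] -/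
theorem IsRPMeasureData.two_step_pos (h : IsRPMeasureData (mΩ := mΩ) μ reflect shift mpos) (F : Ω → ℂ)
    (hF : IsBoundedMeasurable mpos F) :
    0 ≤ RCLike.re (∫ ω, starRingEnd ℂ (F (reflect ω)) * F ((shift ∘ shift) ω) ∂μ) := by
  have hrp : 0 ≤ RCLike.re (h.core.inner (h.shiftOp ⟨F, hF⟩) (h.shiftOp ⟨F, hF⟩)) :=
    h.rp _ (h.shiftOp ⟨F, hF⟩).2
  rw [h.shiftOp_symm] at hrp
  exact hrp

/-- **Osterwalder–Schrader reconstruction, two-step form** (no positivity hypothesis on the one-step shift): every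
reflection-positive measure datum is realised, in the sense of `IsOSRealisation`, with the two-step shift
`shift ∘ shift` implemented by the positive transfer operator `T = S̄²`. [cite: GlimmJaffe1987, §6.1 Thm. 6.1.3]
[cite: OsterwalderSeiler1978, §2] -/
theorem isOSRealisation_two_step (h : IsRPMeasureData (mΩ := mΩ) μ reflect shift mpos) :
    IsOSRealisation (mΩ := mΩ) μ reflect (shift ∘ shift) mpos (rpMap h.two_step)
      (rpTransferData h.two_step h.two_step_pos) :=
  isOSRealisation_of_isRPMeasureData h.two_step h.two_step_pos

end Measure

end Literature.Probability.LatticeModels
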